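import Literature.RepresentationTheory.FiniteGroups.VershikKerovLimitShape
import Literature.NumberTheory.DiophantineGeometry.PartitionTableauxProofs
import Literature.Combinatorics.Enumerative.PartitionNumberUpperBound
import HarnessLib

/-!
# The Plancherel measure of Young diagrams with few rows is exponentially small

Topic `Literature/RepresentationTheory/FiniteGroups`; a sequel to the tree's Vershik–Kerov files
(`VershikKerovHookIntegral`, `…BoundaryWord`, `…UpperReduction`, `…LimitShape`), which prove the
Logan–Shepp–Vershik–Kerov inequality `J(μ) ≥ ½(N log N - N) + S_N/16` for the hook integral
`J(μ) = ∑_{c ∈ μ} K(h(c))` of every `μ ⊢ N` (`lsvk_inequality`). PROVED here: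

* `integral_sq_div_sq_le_neg_logEnergy_of_pos` — the positivity of the logarithmic energy of a
  neutral density with its `H^{1/2}` layers up to ANY scale `R₀`:
  `∫₀^{R₀} s⁻² D(s) ds ≤ -∬ ηη log|u-v|`, `D(s) = ∫ (∫_x^{x+s} η)²` (the tree's
  `integral_sq_div_sq_le_neg_logEnergy` is `R₀ = 1`; same proof);
* `mul_mul_sq_le_integral_sq_div_sq` — `R₀ · w · m² ≤ ∫₀^{R₀} s⁻² D(s) ds` when `η ≤ -m` on an
  interval of length `w + R₀`;
* `lsvk_inequality_fewRows` — **the few-rows inequality**: if `μ ⊢ N` has at most `θ · 2√N`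
  rows, `θ < 1`, then `J(μ) ≥ ½(N log N - N) + κ(θ) N` with
  `κ(θ) = (1-θ)² F₁(-1 + (1-θ)/4)² / 8 > 0` (`F₁ = arcsineCDF 1`): left of `-θ·2√N` the rotated
  boundary of `μ` has no ascending slot while the arcsine density of the limit shape is still
  positive, so `η = p - F_a` is `≤ -F₁(-1+(1-θ)/4)` on a strip of length `(1-θ)√N` and the layers
  at scale `s ≍ √N` contribute `≍ N` — the mechanism of Logan–Shepp 1977 / Vershik–Kerov 1977
  (shapes macroscopically far from `Ω` have hook integral larger by `≍ N`), in the layer form of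
  the tree; cf. Romik, *The Surprising Mathematics of Longest Increasing Subsequences*, §1.17,
  proof of Thm. 1.20 (`P(λ⁽ⁿ⁾ = λ) ≤ exp(-ε²n + O(√n log n))` for `‖ψ_λ - Ω‖_Q > ε`);
* `sq_numStandardTableaux_le_of_fewRows` — `(f^μ)² ≤ N! e^{½ log N + 1 - 2κN}` for such `μ`
  (hook length formula and Stirling);
* `sum_sq_numStandardTableaux_fewRows_le` — **for `0 < x < 2` there are `c > 0`, `n₀` with
  `∑_{μ ⊢ n, ℓ(μ) ≤ x√n} (f^μ)² ≤ n! e^{-cn}` for `n ≥ n₀`**: the Plancherel measure of the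
  diagrams with at most `x√n` rows — by Schensted's correspondence the lower tail
  `P(lis(σ) ≤ x√n)` for a uniform random permutation `σ ∈ S_n` — decays exponentially at speed `n`
  (`p(n) ≤ e^{nt + π²/6t}`, `card_partition_le_exp_add`, absorbs the number of shapes). The sharp
  rate (a full large deviation principle for `n⁻¹ log P(lis ≤ x√n)` with an explicit rate
  function) is Deuschel–Zeitouni 1999 (Combin. Probab. Comput. 8), not reproduced here; the
  constant `c = κ(x/2)` below is far from optimal.

## References

* A. M. Vershik, S. V. Kerov, Funct. Anal. Appl. 19 (1985) 21–31, §3. [VershikKerov1985]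
* B. F. Logan, L. A. Shepp, Adv. Math. 26 (1977) 206–222. [LoganShepp1977]
* D. Romik, *The Surprising Mathematics of Longest Increasing Subsequences*, CUP 2014, §1.17,
  Theorems 1.20, 1.22, 1.23. [Romik2014]
* C. Schensted, Canad. J. Math. 13 (1961) 179–191, Thms 1–3. [Schensted1961]
* J.-D. Deuschel, O. Zeitouni, *On increasing subsequences of I.I.D. samples*, Combin. Probab.
  Comput. 8 (1999) 247–263 (the sharp lower-tail large deviations; not used).

## Mathlib and tree

Mathlib: `YoungDiagram.length_rowLens`, `Real.neg_pi_div_two_lt_arcsin`,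
`intervalIntegral.integral_mono_on_of_le_Ioo`, `MeasureTheory.setIntegral_mono_on`,
`intervalIntegral.integral_mono_interval`, `Real.exp_log`, `Real.log_le_sub_one_of_pos`,
`Nat.Partition` (`Fintype`), `Finset.card_le_univ`. Tree: everything used by `lsvk_inequality`
(`ascSlot`, `arcsineCDF`, `hookForm_expand`, `hookForm_arcsine`, `hookForm_linear_eq`,
`integral_mul_arcsineLinPot_nonneg`, `hookForm_self_eq_half_logEnergy`, `sum_vkHookKernel_eq_hookForm`,
`integral_sq_div_sq_eq_kernel`, `intervalIntegrable_sq_div_sq`, `integrable_sq_windowIntegral`),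
`vkJCells_le_log_prod_hookLength`, `log_factorial_le`, `numStandardTableaux_mul_prod_hookLength_holds`,
`Nat.Partition.rowLens_youngDiagram`, `card_partition_le_exp_add`. Theorems only; no definitions,
no named facts.
-/

noncomputable section

open _root_.MeasureTheory _root_.Set _root_.Filter intervalIntegral
open scoped Real Topology Interval BigOperators

namespace Literature.RepresentationTheory.FiniteGroups

open Literature.Analysis.Potential

/-! ### Log-energy positivity with layers up to an arbitrary scale -/

/-- **Positivity of the logarithmic energy of a neutral density, with the `H^{1/2}` layers up to
any scale `R₀ > 0`.** For a bounded measurable `η` vanishing off `[-L, L]` with `∫ η = 0`: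
`∫₀^{R₀} s⁻² (∫ (∫_x^{x+s} η)² dx) ds ≤ -∬ η(u) η(v) log|u - v| du dv`
(the tree's `integral_sq_div_sq_le_neg_logEnergy` is the case `R₀ = 1`; same proof: the layer
identity `∫₀ᴿ s⁻² D(s) ds = -∬ ηη log|u-v| + R⁻¹ ∬ ηη |u-v|` for `R ≥ 2L`, monotonicity in `R`
since `D ≥ 0`, and `R → ∞`). Saff–Totik, *Logarithmic Potentials*, Lemma I.1.8 (positivity of
the energy of a neutral signed measure); Vershik–Kerov 1985, Lemma 3 (`H^{1/2}` form). [folklore] -/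
theorem integral_sq_div_sq_le_neg_logEnergy_of_pos {η : ℝ → ℝ} {C L R₀ : ℝ} (hηm : Measurable η)
    (hηC : ∀ x, |η x| ≤ C) (hη0 : ∀ x ∉ Icc (-L) L, η x = 0) (hL : 0 ≤ L) (hR₀ : 0 < R₀)
    (hint : ∫ x, η x = 0) :
    ∫ s in (0:ℝ)..R₀, (∫ x, (∫ t in x..x + s, η t) ^ 2) / s ^ 2 ≤
      -∫ p : ℝ × ℝ, η p.1 * η p.2 * Real.log |p.1 - p.2| := by
  set E : ℝ := ∫ p : ℝ × ℝ, η p.1 * η p.2 * Real.log |p.1 - p.2| with hE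
  set β : ℝ := ∫ p : ℝ × ℝ, η p.1 * η p.2 * |p.1 - p.2| with hβ
  -- integrability of the three kernels
  have hIlog : Integrable (fun p : ℝ × ℝ => η p.1 * η p.2 * Real.log |p.1 - p.2|)
      (volume.prod volume) := by
    refine integrable_mul_mul_kernel (κ := fun t => Real.log |t|) hηm hηm
      (Real.measurable_log.comp continuous_abs.measurable) hηC hηC hη0 hη0
      (integrableOn_Icc_of_intervalIntegrable (by linarith) ?_)
    simp_rw [Real.log_abs]
    exact intervalIntegrable_log'
  have hIabs : Integrable (fun p : ℝ × ℝ => η p.1 * η p.2 * |p.1 - p.2|) (volume.prod volume) :=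
    integrable_mul_mul_kernel (κ := fun t => |t|) hηm hηm continuous_abs.measurable hηC hηC hη0
      hη0 (continuous_abs.continuousOn.integrableOn_compact isCompact_Icc)
  have hIconst : ∀ a : ℝ, Integrable (fun p : ℝ × ℝ => η p.1 * η p.2 * a)
      (volume.prod volume) := fun a =>
    integrable_mul_mul_kernel (κ := fun _ => a) hηm hηm measurable_const hηC hηC hη0 hη0
      (continuous_const.continuousOn.integrableOn_compact isCompact_Icc)
  have hconst : ∀ a : ℝ, ∫ p : ℝ × ℝ, η p.1 * η p.2 * a = 0 := by
    intro a
    have h := integral_prod_mul (μ := volume) (ν := volume) η (fun y => η y * a)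
    rw [hint, zero_mul] at h
    rw [Measure.volume_eq_prod, ← h]
    refine integral_congr_ae (Eventually.of_forall fun p => ?_)
    simp only
    ring
  -- the layer identity for every large `R`
  have key : ∀ R, 0 < R → 2 * L ≤ R →
      ∫ s in (0:ℝ)..R, (∫ x, (∫ t in x..x + s, η t) ^ 2) / s ^ 2 = -E + β / R := by
    intro R hR0' hR
    rw [integral_sq_div_sq_eq_kernel hηm hηC hη0 hL hR0' hR]
    have hsplit : ∀ p : ℝ × ℝ,
        η p.1 * η p.2 * (Real.log R - Real.log |p.1 - p.2| - 1 + |p.1 - p.2| / R) =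
          η p.1 * η p.2 * (Real.log R - 1) - η p.1 * η p.2 * Real.log |p.1 - p.2| +
            R⁻¹ * (η p.1 * η p.2 * |p.1 - p.2|) := by
      intro p; ring
    simp_rw [hsplit]
    rw [MeasureTheory.integral_add, MeasureTheory.integral_sub, MeasureTheory.integral_const_mul,
      hconst, zero_sub, hE, hβ]
    · ring
    · rw [Measure.volume_eq_prod]; exact hIconst _
    · rw [Measure.volume_eq_prod]; exact hIlog
    · rw [Measure.volume_eq_prod]; exact (hIconst _).sub hIlog
    · rw [Measure.volume_eq_prod]; exact (hIabs.const_mul _)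
  -- monotonicity in `R`
  have hnonneg : ∀ s, 0 ≤ (∫ x, (∫ t in x..x + s, η t) ^ 2) / s ^ 2 := fun s =>
    div_nonneg (integral_nonneg fun x => sq_nonneg _) (sq_nonneg _)
  have hmono : ∀ R, R₀ ≤ R → 2 * L ≤ R →
      ∫ s in (0:ℝ)..R₀, (∫ x, (∫ t in x..x + s, η t) ^ 2) / s ^ 2 ≤ -E + β / R := by
    intro R hR1 hR
    rw [← key R (by linarith) hR]
    exact integral_mono_interval le_rfl hR₀.le hR1 (Eventually.of_forall hnonneg)
      (intervalIntegrable_sq_div_sq hηm hηC hη0 hL (by linarith) hR)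
  -- let `R → ∞`
  refine le_of_forall_pos_le_add fun ε hε => ?_
  set R : ℝ := max (max (2 * L) R₀) (|β| / ε) with hR
  have hR1 : R₀ ≤ R := (le_max_right _ _).trans (le_max_left _ _)
  have hR2 : 2 * L ≤ R := (le_max_left _ _).trans (le_max_left _ _)
  have hR3 : |β| / ε ≤ R := le_max_right _ _
  have hRpos : 0 < R := by linarith
  refine (hmono R hR1 hR2).trans ?_
  have hb : β / R ≤ ε := by
    rw [div_le_iff₀ hRpos]
    calc β ≤ |β| := le_abs_self β
      _ = |β| / ε * ε := by field_simp
      _ ≤ R * ε := mul_le_mul_of_nonneg_right hR3 hε.le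
      _ = ε * R := mul_comm _ _
  linarith

/-! ### A lower bound for the layers from one interval where the density keeps away from zero -/

/-- If `η ≤ -m` (`m ≥ 0`) on `(u, v)` then every window `(x, x+s) ⊆ (u, v)` has
`(∫_x^{x+s} η)² ≥ (m s)²`. [folklore] -/
theorem sq_le_sq_intervalIntegral_of_le_neg {η : ℝ → ℝ} {u v m x s : ℝ} (hm : 0 ≤ m)
    (hs : 0 ≤ s) (hη : IntervalIntegrable η volume x (x + s)) (hux : u ≤ x) (hxs : x + s ≤ v)
    (hle : ∀ y ∈ Ioo u v, η y ≤ -m) :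
    (m * s) ^ 2 ≤ (∫ t in x..x + s, η t) ^ 2 := by
  have hsub : ∀ y ∈ Ioo x (x + s), y ∈ Ioo u v := fun y hy =>
    ⟨lt_of_le_of_lt hux hy.1, lt_of_lt_of_le hy.2 hxs⟩
  have hc' : ∫ _ in x..x + s, -m = -(m * s) := by simp [mul_comm]
  have h1 : ∫ t in x..x + s, η t ≤ -(m * s) := by
    rw [← hc']
    exact integral_mono_on_of_le_Ioo (by linarith) hη intervalIntegrable_const
      fun y hy => hle y (hsub y hy)
  have h2 : m * s ≤ -∫ t in x..x + s, η t := by linarith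
  calc (m * s) ^ 2 ≤ (-∫ t in x..x + s, η t) ^ 2 := pow_le_pow_left₀ (mul_nonneg hm hs) h2 2
    _ = (∫ t in x..x + s, η t) ^ 2 := by ring

/-- **Layers over one interval.** If the bounded compactly supported density `η` satisfies
`η ≤ -m` (`m ≥ 0`) on `(u, u + w + R₀)` (`w ≥ 0`, `R₀ > 0`), then
`R₀ · w · m² ≤ ∫₀^{R₀} s⁻² (∫ (∫_x^{x+s} η)² dx) ds`
(for `0 < s < R₀` restrict `x` to `[u, u + w]`, where `(∫_x^{x+s} η)² ≥ m² s²`). [folklore] -/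
theorem mul_mul_sq_le_integral_sq_div_sq {η : ℝ → ℝ} {C L : ℝ} (hηm : Measurable η)
    (hηC : ∀ x, |η x| ≤ C) (hη0 : ∀ x ∉ Icc (-L) L, η x = 0) (hL : 0 ≤ L)
    {u w R₀ m : ℝ} (hw : 0 ≤ w) (hR₀ : 0 < R₀) (hm : 0 ≤ m)
    (hle : ∀ y ∈ Ioo u (u + w + R₀), η y ≤ -m) :
    R₀ * w * m ^ 2 ≤ ∫ s in (0:ℝ)..R₀, (∫ x, (∫ t in x..x + s, η t) ^ 2) / s ^ 2 := by
  have hi : ∀ a b, IntervalIntegrable η volume a b := fun a b =>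
    (integrable_of_bounded_Icc hηm hηC hη0).intervalIntegrable
  -- pointwise in `s ∈ (0, R₀)`
  have hpt : ∀ s ∈ Ioo (0:ℝ) R₀,
      w * m ^ 2 ≤ (∫ x, (∫ t in x..x + s, η t) ^ 2) / s ^ 2 := by
    intro s hs
    have hs0 : 0 < s := hs.1
    rw [le_div_iff₀ (pow_pos hs0 2)]
    set f : ℝ → ℝ := fun x => (∫ t in x..x + s, η t) ^ 2 with hf
    have hfint : Integrable f := integrable_sq_windowIntegral hηm hηC hη0 hs0.le
    set I : Set ℝ := Icc u (u + w) with hI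
    have h1 : ∫ x in I, f x ≤ ∫ x, f x :=
      setIntegral_le_integral hfint (Eventually.of_forall fun x => sq_nonneg _)
    have hvol : volume.real I = w := by
      simp only [hI]
      rw [Real.volume_real_Icc_of_le (by linarith)]
      ring
    have h3 : (m * s) ^ 2 * w ≤ ∫ x in I, f x := by
      calc (m * s) ^ 2 * w = ∫ _ in I, (m * s) ^ 2 := by
            rw [setIntegral_const, hvol, smul_eq_mul, mul_comm]
        _ ≤ ∫ x in I, f x := by
            refine setIntegral_mono_on (integrableOn_const (by simp [hI])) hfint.integrableOn
              measurableSet_Icc fun x hx => ?_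
            exact sq_le_sq_intervalIntegral_of_le_neg hm hs0.le (hi _ _) hx.1
              (by linarith [hx.2, hs.2]) hle
    calc w * m ^ 2 * s ^ 2 = (m * s) ^ 2 * w := by ring
      _ ≤ ∫ x in I, f x := h3
      _ ≤ ∫ x, f x := h1
  -- integrate over `s ∈ (0, R₀)`
  have hR : IntervalIntegrable (fun s => (∫ x, (∫ t in x..x + s, η t) ^ 2) / s ^ 2)
      volume 0 R₀ := by
    have h := intervalIntegrable_sq_div_sq hηm hηC hη0 hL (R := max (2 * L) R₀)
      (lt_of_lt_of_le hR₀ (le_max_right _ _)) (le_max_left _ _)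
    exact h.mono_set (by
      rw [uIcc_of_le hR₀.le, uIcc_of_le (hR₀.le.trans (le_max_right _ _))]
      exact Icc_subset_Icc le_rfl (le_max_right _ _))
  have hlhs : ∫ _ in (0:ℝ)..R₀, w * m ^ 2 = R₀ * w * m ^ 2 := by
    rw [intervalIntegral.integral_const, smul_eq_mul, sub_zero]
    ring
  rw [← hlhs]
  exact integral_mono_on_of_le_Ioo hR₀.le intervalIntegrable_const hR hpt

/-! ### Slots left of all rows are descending -/

open VershikKerov

/-- Left of `-λ'_0` (minus the number of rows) every unit slot of the rotated boundary is
descending: `p(x) = 0` for `x < -colLen 0`. [folklore] -/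
theorem ascSlot_of_lt_neg_colLen {Y : YoungDiagram} {R : ℕ} {x : ℝ}
    (hx : x < -(Y.colLen 0 : ℝ)) : ascSlot Y R x = 0 := by
  unfold ascSlot
  have hfl : ⌊x⌋ < -(Y.colLen 0 : ℤ) := Int.floor_lt.mpr (by exact_mod_cast hx)
  rw [if_neg]
  push Not
  refine ⟨fun h => ?_, by omega⟩
  obtain ⟨j, -, hj⟩ := Finset.mem_image.mp h
  have := neg_le_upPos Y j
  omega

/-! ### The few-rows inequality for the hook integral -/

/-- The arcsine distribution function `F_a` is positive right of `-a`. [folklore] -/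
theorem arcsineCDF_pos {a x : ℝ} (ha : 0 < a) (hx : -a < x) : 0 < arcsineCDF a x := by
  have hπ := Real.pi_pos
  unfold arcsineCDF
  have h0 : -1 < x / a := by rw [lt_div_iff₀ ha]; linarith
  have h1 : -(π / 2) < Real.arcsin (x / a) := Real.neg_pi_div_two_lt_arcsin.mpr h0
  have h2 : -(1 / 2) < Real.arcsin (x / a) / π := by
    rw [lt_div_iff₀ hπ]; linarith
  linarith

/-- Scale invariance at the test point: `F_a(-a + (1-θ)a/4) = F_1(-1 + (1-θ)/4)`. [folklore] -/
theorem arcsineCDF_testPoint {a : ℝ} (θ : ℝ) (ha : 0 < a) :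
    arcsineCDF a (-a + (1 - θ) / 4 * a) = arcsineCDF 1 (-1 + (1 - θ) / 4) := by
  unfold arcsineCDF
  have : (-a + (1 - θ) / 4 * a) / a = (-1 + (1 - θ) / 4) / 1 := by
    field_simp
  rw [this]

/-- **The few-rows inequality (Vershik–Kerov 1985 §3 / Logan–Shepp 1977, quantitative form used by
Romik, *The Surprising Mathematics of Longest Increasing Subsequences*, §1.17, proof of Thm. 1.20).**
For `N ≥ 1`, `θ < 1` and `μ ⊢ N` with at most `θ · 2√N` rows:
`J(μ) ≥ ½(N log N - N) + κ(θ) N`, `κ(θ) = (1-θ)² F₁(-1+(1-θ)/4)²/8` (`> 0`, `arcsineCDF_pos`).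
Proof: as in the tree's `lsvk_inequality`, `J(μ) = 𝔅(F,1-F) + [linear ≥ 0] - 𝔅(η,η)` with
`η = p - F_a`, `a = 2√N`, and `-𝔅(η,η) = -½∬ηη log|x-y| ≥ ½ ∫₀^{δ} s⁻² D(s) ds`
(`integral_sq_div_sq_le_neg_logEnergy_of_pos`, `δ = (1-θ)a/4`); left of `-θa ≤ -λ'_0` there are
no ascending slots, so on `(-a+δ, -a+3δ)` the density is `η = -F_a ≤ -F_a(-a+δ) = -F₁(-1+(1-θ)/4)`
(`arcsineCDF_testPoint`), and `∫₀^δ s⁻² D(s) ds ≥ δ · δ · F₁(…)² = (1-θ)² F₁(…)² N / 4`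
(`mul_mul_sq_le_integral_sq_div_sq`).
[cite: VershikKerov1985, §3] -/
theorem lsvk_inequality_fewRows (N : ℕ) (hN : 1 ≤ N) (μ : Nat.Partition N) {θ : ℝ} (hθ : θ < 1)
    (hrows : (Multiset.card μ.parts : ℝ) ≤ θ * (2 * Real.sqrt N)) :
    ((N : ℝ) * Real.log N - N) / 2 +
      (1 - θ) ^ 2 * arcsineCDF 1 (-1 + (1 - θ) / 4) ^ 2 / 8 * N ≤ vkJCells μ := by
  -- Set-up (`Y, a, R, F, φ, η`, neutrality, equal areas, signs) repeated verbatim from the tree's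
  -- `lsvk_inequality` (adapted from `VershikKerovLimitShape.lean`, which is append-only).
  have hπ := Real.pi_pos
  set Y := μ.youngDiagram with hY
  have hcard : Y.cells.card = N := μ.card_cells_youngDiagram
  set a : ℝ := 2 * Real.sqrt N with ha
  have hN0 : (0:ℝ) < N := by exact_mod_cast hN
  have hsqrt : 0 < Real.sqrt N := Real.sqrt_pos.mpr hN0
  have ha0 : 0 < a := by positivity
  have hsq : Real.sqrt (N : ℝ) ^ 2 = N := Real.sq_sqrt hN0.le
  set R : ℕ := max (max (Y.rowLen 0) (Y.colLen 0)) ⌈a⌉₊ with hR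
  have hR₁ : Y.rowLen 0 ≤ R := (le_max_left _ _).trans (le_max_left _ _)
  have hR₂ : Y.colLen 0 ≤ R := (le_max_right _ _).trans (le_max_left _ _)
  have haR : a ≤ R := (Nat.le_ceil a).trans (by exact_mod_cast le_max_right _ _)
  have hR0 : (0:ℝ) ≤ R := Nat.cast_nonneg R
  set F : ℝ → ℝ := arcsineCDF a with hF
  set φ : ℝ → ℝ := ascSlot Y R with hφ
  set η : ℝ → ℝ := fun x => φ x - F x with hη
  -- properties of `η`
  have hηm : Measurable η := (measurable_ascSlot R).sub (continuous_arcsineCDF a).measurable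
  have hηC : ∀ x, |η x| ≤ 1 := by
    intro x
    simp only [hη, hφ, hF]
    rw [abs_le]
    constructor <;> linarith [ascSlot_nonneg (Y := Y) R x, ascSlot_le_one (Y := Y) R x,
      arcsineCDF_nonneg a x, arcsineCDF_le_one a x]
  have hη0 : ∀ x ∉ Icc (-(R : ℝ)) R, η x = 0 := by
    intro x hx
    simp only [hη, hφ, hF]
    rcases not_and_or.mp hx with h | h
    · have hx' : x < -(R : ℝ) := not_le.mp h
      rw [ascSlot_of_lt_neg hR₂ hx', arcsineCDF_of_le_neg ha0 (by linarith)]; ring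
    · have hx' : (R : ℝ) < x := not_le.mp h
      rw [ascSlot_of_le hx'.le, arcsineCDF_of_le ha0 (by linarith)]; ring
  have hRR : -(R : ℝ) ≤ R := by linarith
  have hred : ∀ {g : ℝ → ℝ}, (∀ x ∉ Icc (-(R : ℝ)) R, g x = 0) →
      ∫ x, g x = ∫ x in (-(R : ℝ))..R, g x := by
    intro g hg
    rw [integral_of_le hRR, ← integral_Icc_eq_integral_Ioc]
    exact (setIntegral_eq_integral_of_forall_compl_eq_zero fun x hx => hg x hx).symm
  -- charge neutrality `∫ η = 0`
  have hint0 : ∫ x, η x = 0 := by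
    rw [hred hη0]
    simp only [hη, hφ, hF]
    rw [intervalIntegral.integral_sub (intervalIntegrable_ascSlot R _ _)
      ((continuous_arcsineCDF a).intervalIntegrable _ _), integral_ascSlot hR₂, integral_arcsineCDF]
    ring
  -- equal areas `∫ x η(x) dx = 0`
  have hint1 : ∫ x, x * η x = 0 := by
    rw [hred (g := fun x => x * η x) fun x hx => by rw [hη0 x hx, mul_zero] ]
    have hsplit : ∀ x, x * η x = x * ascSlot Y R x - x * arcsineCDF a x := fun x => by
      simp only [hη, hφ, hF]; ring
    simp_rw [hsplit]
    have hi1 : IntervalIntegrable (fun x => x * ascSlot Y R x) volume (-(R : ℝ)) R :=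
      (intervalIntegrable_ascSlot R _ _).continuousOn_mul continuous_id.continuousOn
    have hi2 : IntervalIntegrable (fun x => x * arcsineCDF a x) volume (-(R : ℝ)) R :=
      (continuous_id.mul (continuous_arcsineCDF a)).intervalIntegrable _ _
    rw [intervalIntegral.integral_sub hi1 hi2,
      integral_id_mul_ascSlot hR₁ hR₂, integral_id_mul_arcsineCDF ha0 haR, hcard, ha]
    nlinarith [hsq]
  -- signs outside `[-a, a]`
  have hpos : ∀ x, x < -a → 0 ≤ η x := fun x hx => by
    simp only [hη, hφ, hF]
    rw [arcsineCDF_of_le_neg ha0 hx.le, sub_zero]; exact ascSlot_nonneg R x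
  have hneg : ∀ x, a < x → η x ≤ 0 := fun x hx => by
    simp only [hη, hφ, hF]
    rw [arcsineCDF_of_le ha0 hx.le]; linarith [ascSlot_le_one (Y := Y) R x]
  -- the empty strip left of all rows: `colLen 0 ≤ θ a`
  have hcol : (Y.colLen 0 : ℝ) ≤ θ * a := by
    have h1 : Y.colLen 0 = Multiset.card μ.parts := by
      rw [← YoungDiagram.length_rowLens, hY, μ.rowLens_youngDiagram, μ.length_sortedParts]
    rw [h1, ha]; exact hrows
  set δ : ℝ := (1 - θ) / 4 * a with hδ
  have hθ' : 0 < 1 - θ := by linarith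
  have hδ0 : 0 < δ := by positivity
  set u : ℝ := -a + δ with hu
  set m : ℝ := arcsineCDF a u with hmdef
  have hm_eq : m = arcsineCDF 1 (-1 + (1 - θ) / 4) := by
    rw [hmdef, hu, hδ]
    exact arcsineCDF_testPoint θ ha0
  have hm0 : 0 ≤ m := arcsineCDF_nonneg a u
  have hle : ∀ y ∈ Ioo u (u + δ + δ), η y ≤ -m := by
    intro y hy
    have hy2 : y < -(Y.colLen 0 : ℝ) := by
      have h3 : u + δ + δ + θ * a = -δ := by
        simp only [hu, hδ]; ring
      linarith [hy.2, hcol]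
    have hφy : φ y = 0 := ascSlot_of_lt_neg_colLen hy2
    have hmono := monotone_arcsineCDF ha0 hy.1.le
    simp only [hη, hφy, hF, zero_sub, neg_le_neg_iff]
    rw [hmdef]
    exact hmono
  -- the analytic inputs
  have hQ1 := integral_sq_div_sq_le_neg_logEnergy_of_pos hηm hηC hη0 hR0 hδ0 hint0
  have hQ2 := mul_mul_sq_le_integral_sq_div_sq hηm hηC hη0 hR0 hδ0.le hδ0 hm0 hle
  have hB1 := hookForm_self_eq_half_logEnergy hηm hηC hη0 hR0
  have hLin : 0 ≤ (∫ p : ℝ × ℝ, upperLogKernel p * η p.1 * (1 - arcsineCDF a p.2)) -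
      ∫ p : ℝ × ℝ, upperLogKernel p * arcsineCDF a p.1 * η p.2 := by
    rw [hookForm_linear_eq hηm hηC hη0 hR0 ha0]
    exact integral_mul_arcsineLinPot_nonneg hηm hηC hη0 ha0 hint0 hint1 hpos hneg
  have hΩ : ∫ p : ℝ × ℝ, upperLogKernel p * arcsineCDF a p.1 * (1 - arcsineCDF a p.2) =
      ((N : ℝ) * Real.log N - N) / 2 := by
    rw [hookForm_arcsine ha0, ha, show 2 * Real.sqrt N / 2 = Real.sqrt N by ring,
      Real.log_sqrt hN0.le, show (2 * Real.sqrt (N : ℝ)) ^ 2 / 4 = N by rw [mul_pow, hsq]; ring]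
    ring
  have hexp := hookForm_expand ha0 haR hηm hηC hη0 (φ := φ) (fun x => by simp only [hη]; ring)
  have hJ : vkJCells μ = ∫ p : ℝ × ℝ, upperLogKernel p * φ p.1 * (1 - φ p.2) := by
    rw [vkJCells, sum_vkHookKernel_eq_hookForm hR₁ hR₂]
    refine integral_congr_ae (Eventually.of_forall fun p => ?_)
    simp only [hφ]
    rw [← ascSlot_add_descSlot hR₁ hR₂ p.2]
    ring
  have haa : a * a = 4 * N := by rw [ha]; nlinarith [hsq]
  have hrate : (1 - θ) ^ 2 * arcsineCDF 1 (-1 + (1 - θ) / 4) ^ 2 / 8 * N =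
      δ * δ * m ^ 2 / 2 := by
    rw [← hm_eq, hδ]
    linear_combination (-(1 - θ) ^ 2 * m ^ 2 / 32) * haa
  rw [hJ, hexp, hΩ, hB1]
  linarith

/-! ### From the hook integral to `(f^μ)²` and to the Plancherel measure of few-rows shapes -/

open Literature.NumberTheory.DiophantineGeometry (numStandardTableaux hookLength one_le_hookLength
  numStandardTableaux_mul_prod_hookLength_holds)
open Literature.Combinatorics.Enumerative (card_partition_le_exp_add)

/-- **Per-shape bound.** For `N ≥ 1`, `θ < 1` and `μ ⊢ N` with at most `θ·2√N` rows,
`(f^μ)² ≤ N! · exp(½ log N + 1 - 2κ(θ)N)`, `κ(θ) = (1-θ)² F₁(-1+(1-θ)/4)²/8` (hook length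
formula `f^μ ∏ h = N!`,
`log ∏ h ≥ J(μ) ≥ ½(N log N - N) + κN`, and Stirling `log N! ≤ N log N - N + ½ log N + 1`).
[cite: VershikKerov1985, §3] -/
theorem sq_numStandardTableaux_le_of_fewRows (N : ℕ) (hN : 1 ≤ N) (μ : Nat.Partition N) {θ : ℝ}
    (hθ : θ < 1) (hrows : (Multiset.card μ.parts : ℝ) ≤ θ * (2 * Real.sqrt N)) :
    ((numStandardTableaux μ : ℕ) : ℝ) ^ 2 ≤
      (N.factorial : ℝ) * Real.exp (Real.log N / 2 + 1 -
        2 * ((1 - θ) ^ 2 * arcsineCDF 1 (-1 + (1 - θ) / 4) ^ 2 / 8) * N) := by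
  set H : ℝ := ∏ c ∈ μ.youngDiagram.cells, (hookLength μ.youngDiagram c : ℝ) with hH
  have hHpos : 0 < H := Finset.prod_pos fun c hc => by exact_mod_cast one_le_hookLength hc
  have hfac : (0 : ℝ) < N.factorial := by exact_mod_cast N.factorial_pos
  have hfH : (numStandardTableaux μ : ℝ) * H = N.factorial := by
    have h := numStandardTableaux_mul_prod_hookLength_holds (d := N) μ
    rw [hH]
    exact_mod_cast h
  have h1 := vkJCells_le_log_prod_hookLength μ
  have h2 := lsvk_inequality_fewRows N hN μ hθ hrows
  have h4 := log_factorial_le hN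
  set E : ℝ := Real.log N / 2 + 1 -
    2 * ((1 - θ) ^ 2 * arcsineCDF 1 (-1 + (1 - θ) / 4) ^ 2 / 8) * N with hE
  have key : Real.log (N.factorial : ℝ) ≤ E + 2 * Real.log H := by
    rw [hE]; rw [← hH] at h1; linarith
  have hmain : (N.factorial : ℝ) ≤ Real.exp E * H ^ 2 := by
    calc (N.factorial : ℝ) = Real.exp (Real.log (N.factorial : ℝ)) := (Real.exp_log hfac).symm
      _ ≤ Real.exp (E + 2 * Real.log H) := Real.exp_le_exp.mpr key
      _ = Real.exp E * H ^ 2 := by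
          have hlog2 : 2 * Real.log H = Real.log (H ^ 2) := by
            rw [Real.log_pow]; norm_num
          rw [Real.exp_add, hlog2, Real.exp_log (pow_pos hHpos 2)]
  have hf : (numStandardTableaux μ : ℝ) = N.factorial / H := by
    rw [eq_div_iff hHpos.ne']; exact hfH
  rw [hf, div_pow, div_le_iff₀ (pow_pos hHpos 2)]
  calc (N.factorial : ℝ) ^ 2 = N.factorial * N.factorial := by ring
    _ ≤ N.factorial * (Real.exp E * H ^ 2) := mul_le_mul_of_nonneg_left hmain hfac.le
    _ = N.factorial * Real.exp E * H ^ 2 := by ring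

/-- **Plancherel measure of the shapes with few rows (Logan–Shepp 1977 / Vershik–Kerov 1977, 1985;
quantitative form as in Romik, *The Surprising Mathematics of Longest Increasing Subsequences*,
§1.17, proof of Thm. 1.20; the sharp large-deviation rate is Deuschel–Zeitouni 1999).**
For `0 < x < 2` there are `c > 0` and `n₀` such that for all `n ≥ n₀`,
`Σ_{μ ⊢ n, ℓ(μ) ≤ x√n} (f^μ)² ≤ n! · e^{-cn}` (`ℓ(μ)` = number of parts): the Plancherel
measure `(f^μ)²/n!` of the Young diagrams with at most `x√n` rows is exponentially small at speed
`n` — by Schensted's correspondence, the lower tail `P(lis ≤ x√n)` of the longest increasing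
subsequence of a uniform random permutation. Proof: each such `μ` has
`(f^μ)² ≤ n! e^{½ log n + 1 - 2κn}` (`sq_numStandardTableaux_le_of_fewRows`, `θ = x/2`,
`κ = κ(θ)`), there are `p(n) ≤ e^{nκ/2 + π²/(3κ)}` partitions (`card_partition_le_exp_add`), and
`½ log n + 1 + π²/(3κ) ≤ κn/2` for large `n`; `c = κ`.
[cite: VershikKerov1985, §3] [cite: Romik2014, §1.17 (proof of Theorem 1.20)] -/
theorem sum_sq_numStandardTableaux_fewRows_le (x : ℝ) (hx0 : 0 < x) (hx : x < 2) :
    ∃ c : ℝ, 0 < c ∧ ∃ n₀ : ℕ, ∀ n ≥ n₀,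
      ((∑ μ ∈ (Finset.univ.filter fun μ : Nat.Partition n =>
          (Multiset.card μ.parts : ℝ) ≤ x * Real.sqrt n), numStandardTableaux μ ^ 2 : ℕ) : ℝ) ≤
        (n.factorial : ℝ) * Real.exp (-(c * n)) := by
  have hπ := Real.pi_pos
  set θ : ℝ := x / 2 with hθ
  have hθ1 : θ < 1 := by rw [hθ]; linarith
  set κ : ℝ := (1 - θ) ^ 2 * arcsineCDF 1 (-1 + (1 - θ) / 4) ^ 2 / 8 with hκ
  have hκ0 : 0 < κ := by
    have h1 : 0 < arcsineCDF 1 (-1 + (1 - θ) / 4) := arcsineCDF_pos one_pos (by linarith)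
    have h2 : 0 < 1 - θ := by linarith
    positivity
  -- the threshold: `√n ≥ M` where `κ M / 2 ≥ κ/2 · ... `
  set C : ℝ := 1 + π ^ 2 / (6 * (κ / 2)) with hC
  have hC0 : 0 < C := by positivity
  set M : ℝ := 2 * (1 + C) / κ with hM
  have hM0 : 0 < M := by positivity
  refine ⟨κ, hκ0, ⌈M ^ 2⌉₊ + 1, fun n hn => ?_⟩
  have hn1 : 1 ≤ n := le_trans (Nat.le_add_left 1 _) hn
  have hn0 : (0 : ℝ) < n := by exact_mod_cast hn1
  have hMn : M ≤ Real.sqrt n := by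
    rw [Real.le_sqrt hM0.le hn0.le]
    have h1 : (M ^ 2 : ℝ) ≤ ⌈M ^ 2⌉₊ := Nat.le_ceil _
    have h2 : ((⌈M ^ 2⌉₊ + 1 : ℕ) : ℝ) ≤ n := by exact_mod_cast hn
    push_cast at h2
    linarith
  have hsqrt0 : 0 < Real.sqrt n := Real.sqrt_pos.mpr hn0
  have hsq : Real.sqrt (n : ℝ) ^ 2 = n := Real.sq_sqrt hn0.le
  -- per-shape bound on the filter
  set S := (Finset.univ.filter fun μ : Nat.Partition n =>
    (Multiset.card μ.parts : ℝ) ≤ x * Real.sqrt n) with hS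
  set B : ℝ := (n.factorial : ℝ) * Real.exp (Real.log n / 2 + 1 - 2 * κ * n) with hB
  have hB0 : 0 ≤ B := by positivity
  have hterm : ∀ μ ∈ S, ((numStandardTableaux μ : ℕ) : ℝ) ^ 2 ≤ B := by
    intro μ hμ
    rw [hS, Finset.mem_filter] at hμ
    have hrows : (Multiset.card μ.parts : ℝ) ≤ θ * (2 * Real.sqrt n) := by
      rw [hθ]; linarith [hμ.2]
    exact sq_numStandardTableaux_le_of_fewRows n hn1 μ hθ1 hrows
  have hsum : ((∑ μ ∈ S, numStandardTableaux μ ^ 2 : ℕ) : ℝ) ≤ S.card * B := by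
    push_cast
    calc ∑ μ ∈ S, ((numStandardTableaux μ : ℕ) : ℝ) ^ 2 ≤ ∑ _μ ∈ S, B :=
          Finset.sum_le_sum hterm
      _ = S.card * B := by rw [Finset.sum_const, nsmul_eq_mul]
  -- number of shapes
  have hcardS : (S.card : ℝ) ≤ Real.exp (n * (κ / 2) + π ^ 2 / (6 * (κ / 2))) := by
    have h1 : S.card ≤ Fintype.card (Nat.Partition n) := Finset.card_le_univ _
    have h2 : (S.card : ℝ) ≤ Fintype.card (Nat.Partition n) := by exact_mod_cast h1
    exact h2.trans (card_partition_le_exp_add (by positivity) n)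
  -- the exponent bookkeeping
  have hlog : Real.log n ≤ 2 * Real.sqrt n := by
    -- `log √n ≤ √n - 1` (the tree's `SelbergSymmetry.log_le_two_mul_sqrt`, inlined)
    have h1 : Real.log (Real.sqrt n) ≤ Real.sqrt n - 1 := Real.log_le_sub_one_of_pos hsqrt0
    rw [Real.log_sqrt hn0.le] at h1
    linarith
  have hsqrt_le : Real.sqrt (n : ℝ) ≤ n := by
    have hn1' : (1 : ℝ) ≤ n := by exact_mod_cast hn1
    rw [Real.sqrt_le_left (by linarith)]
    nlinarith
  have hexp_le : n * (κ / 2) + π ^ 2 / (6 * (κ / 2)) + (Real.log n / 2 + 1 - 2 * κ * n) ≤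
      -(κ * n) := by
    -- `1 + C' + √n ≤ ... `: from `M ≤ √n`, `κ √n / 2 ≥ 1 + C`, and `√n ≤ n`
    have h1 : 1 + C ≤ κ / 2 * Real.sqrt n := by
      have := (div_le_iff₀ hκ0).mp (show 2 * (1 + C) / κ ≤ Real.sqrt n from hMn)
      linarith
    have h2 : κ / 2 * Real.sqrt n ≤ κ / 2 * n := mul_le_mul_of_nonneg_left hsqrt_le (by positivity)
    have h3 : Real.log n / 2 ≤ Real.sqrt n := by linarith
    have h4 : Real.sqrt n ≤ κ / 2 * n / (1 : ℝ) := by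
      -- `√n ≥ M ≥ 2/κ` gives `√n · √n ≥ (2/κ) √n`, i.e. `n ≥ (2/κ)√n`
      have hM2 : 2 / κ ≤ M := by
        rw [hM]
        exact div_le_div_of_nonneg_right (by linarith) hκ0.le
      have h5 : 2 / κ ≤ Real.sqrt n := hM2.trans hMn
      have h6 : 2 / κ * Real.sqrt n ≤ Real.sqrt n * Real.sqrt n :=
        mul_le_mul_of_nonneg_right h5 hsqrt0.le
      rw [← sq, hsq] at h6
      rw [div_one]
      have h7 : Real.sqrt n = κ / 2 * (2 / κ * Real.sqrt n) := by field_simp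
      rw [h7]
      exact mul_le_mul_of_nonneg_left h6 (by positivity)
    rw [hC] at h1
    nlinarith [h1, h2, h3, h4]
  calc ((∑ μ ∈ S, numStandardTableaux μ ^ 2 : ℕ) : ℝ) ≤ S.card * B := hsum
    _ ≤ Real.exp (n * (κ / 2) + π ^ 2 / (6 * (κ / 2))) * B :=
        mul_le_mul_of_nonneg_right hcardS hB0
    _ = (n.factorial : ℝ) * (Real.exp (n * (κ / 2) + π ^ 2 / (6 * (κ / 2))) *
          Real.exp (Real.log n / 2 + 1 - 2 * κ * n)) := by
        rw [hB]; ring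
    _ = (n.factorial : ℝ) * Real.exp (n * (κ / 2) + π ^ 2 / (6 * (κ / 2)) +
          (Real.log n / 2 + 1 - 2 * κ * n)) := by
        rw [← Real.exp_add]
    _ ≤ (n.factorial : ℝ) * Real.exp (-(κ * n)) :=
        mul_le_mul_of_nonneg_left (Real.exp_le_exp.mpr hexp_le) (Nat.cast_nonneg _)

end Literature.RepresentationTheory.FiniteGroups

end
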